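import Literature.IUT.HodgeTheaters.HodgeTheaterModelFKitCor56iLaws
import HarnessLib

/-!
# [IUTchI] Cor 5.6 (i) under ruling (b): the EXACT local content is «`Aut(ℱ̲_v) → Aut(𝒟_v)` bijective at every
# `v`»; the typed rows L02 and L04 (Cor 5.3 (ii)) are sufficient but NOT necessary (proof-only; 0 definitions)

S. Mochizuki, *Inter-universal Teichmüller theory I*, kurims manuscript (May 2020), §5, Corollary 5.6 (i), statement
p. 153 l. 67–70, proof p. 154 l. 8–24; Corollary 5.3 (ii), (iv) p. 144 ([IUTchI] Cor 5.6 (i) p.153)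
[claim: Mochizuki2012, status: disputed] (D-0012 claim key; nothing of the series is asserted, no side is taken on
[IUTchIII] Cor. 3.12).

Proof-only file of the abc-iut cell (node IUTchI:Cor5.6(i), sub-DAG `plan/L5/SUBDAG-IUTchI-Cor56i.md`, writer of record
abc-iut-w5-d217).  The sub-DAG derives the ruling-(b) form `Cor56iKitCanonical` of Cor 5.6 (i) (bijectivity of
`Isom(†ℋ𝒯^Θ, ‡ℋ𝒯^Θ) → Isom(†𝔇_>, ‡𝔇_>)` for canonically framed theaters) from rows L02 `ThToFBijOnGood`, L04 = Cor 5.3 (ii)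
`IsomFtoDBijective`, L05 = Cor 5.3 (iv) `AutTemperedBijective`, L03a `RlfIsoFaithful` and functoriality `RlfOfNatural`
(`cor56iKitCanonical_of_laws`, p424893).  Here the local rows are replaced by their EXACT content:

* `cor56iKitCanonical_iff_localBijective` — given rigidity L03a, functoriality and ONE canonically framed theater,
  `Cor56iKitCanonical` holds IFF at EVERY `v ∈ 𝕍` the composite functor `ℱ̲_v ↦ ℱ_v ↦ 𝒟_v` (`thToF v ⋙ toD v`) is
  bijective on `Aut(ℱ̲_v)` (the statement of Cor 5.3 (iv), printed for `v ∈ 𝕍^bad`, at ALL `v`).  So row L05 is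
  NECESSARY (`autTemperedBijective_of_cor56iKitCanonical`), while rows L02 and L04 enter only through this composite;
* `localBijective_of_rows` — L02 + L04 + L05 give the local condition (so the iff recovers `cor56iKitCanonical_of_laws`);
* `exists_fkit_cor56iKit_not_isomFtoDBijective` — a kit over ANY base kit with a place in which L03a, functoriality,
  L05, the local condition and BOTH forms `Cor56iKit`/`Cor56iKitCanonical` of Cor 5.6 (i) HOLD (every theater is
  canonically framed) while Cor 5.3 (ii) `IsomFtoDBijective` FAILS, and L02 fails at every good place: the
  `ℱ_v`-ambient is `(isomorphs of 𝒟_v) × SingleObj ℤˣ` with base functor the first projection, and `ℱ̲_v ↦ ℱ_v` is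
  `A ↦ (A, ⋆)` — the automorphism `−1` of the second factor is an automorphism of the `ℱ`-prime-strip over the identity
  of the `𝒟`-prime-strip that no Θ-Hodge theater sees;
* `not_forall_isomFtoDBijective_of_cor56iKit`, `not_forall_thToFBijOnGood_of_cor56iKit` — hence rows L04 and L02 are
  NOT necessary for Cor 5.6 (i) as typed (refuted schemata), complementing `rlfDetermined_of_cor56iKit` (L03 IS
  necessary, p414027) and the tightness theorems of `FKitCoreBridgeCanonical.lean` / `FKitCanonicalStrictness.lean`.

Honest scope: statements about the TYPED predicates of the kit interface (which rows imply which); print's proof cites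
Cor 5.3 (ii) and the identification `†ℱ_{>,v} = †ℱ̲_v` at good `v`, which together give exactly the local condition at
good `v`.  Typed ≠ proved for the genuine instance.
-/

namespace Literature.IUT.HodgeTheaters

open CategoryTheory

namespace PMBaseKit.FKit

universe u

variable {l : ℕ} {K : PMBaseKit.{u} l} {M : K.MultKit} {FK : K.FKit M}

/-! ### Plumbing (Mathlib folklore; the copies in `ThetaHodgeTheatersCor56iSub.lean` are private) -/

/-- Conjugation transport: a functor bijective on `Aut(A)` is bijective on `Isom(X, Y)` for isomorphs `X, Y` of `A`.
[folklore] -/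
private theorem mapIso_bijective_conj' {C : Type*} [Category C] {E : Type*} [Category E] (G : C ⥤ E) {A X Y : C}
    (h : Function.Bijective fun α : A ≅ A => G.mapIso α) (eX : X ≅ A) (eY : Y ≅ A) :
    Function.Bijective fun φ : X ≅ Y => G.mapIso φ := by
  have key : ∀ φ : X ≅ Y, eX ≪≫ (eX.symm ≪≫ φ ≪≫ eY) ≪≫ eY.symm = φ := fun φ => by ext; simp
  constructor
  · intro φ₁ φ₂ hφ
    have h' : G.mapIso (eX.symm ≪≫ φ₁ ≪≫ eY) = G.mapIso (eX.symm ≪≫ φ₂ ≪≫ eY) := by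
      have hφ' : G.mapIso φ₁ = G.mapIso φ₂ := hφ
      simp only [Functor.mapIso_trans, hφ']
    have h2 := h.1 h'
    rw [← key φ₁, ← key φ₂]
    exact congrArg (fun β => eX ≪≫ β ≪≫ eY.symm) h2
  · intro ψ
    obtain ⟨α, hα⟩ := h.2 ((G.mapIso eX).symm ≪≫ ψ ≪≫ G.mapIso eY)
    refine ⟨eX ≪≫ α ≪≫ eY.symm, ?_⟩
    have hα' : G.mapIso α = (G.mapIso eX).symm ≪≫ ψ ≪≫ G.mapIso eY := hα
    show G.mapIso (eX ≪≫ α ≪≫ eY.symm) = ψ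
    simp only [Functor.mapIso_trans, Functor.mapIso_symm, hα']
    ext; simp

/-- A family of bijections is a bijection of families. [folklore] -/
private theorem pi_map_bijective' {ι : Sort*} {α β : ι → Sort*} (f : ∀ i, α i → β i)
    (hf : ∀ i, Function.Bijective (f i)) :
    Function.Bijective fun (a : ∀ i, α i) (i : ι) => f i (a i) := by
  refine ⟨fun a b h => funext fun i => (hf i).1 (congrFun h i), fun b => ?_⟩
  choose a ha using fun i => (hf i).2 (b i); exact ⟨a, funext ha⟩

/-- Conversely, if the map of families is a bijection and every `α i` is inhabited, each component is a bijection
(vary one coordinate, fix the others at a base point). [folklore] -/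
private theorem bijective_of_pi_map_bijective {ι : Type*} {α β : ι → Type*} (f : ∀ i, α i → β i)
    (a₀ : ∀ i, α i) (hf : Function.Bijective fun (a : ∀ i, α i) (i : ι) => f i (a i)) (i : ι) :
    Function.Bijective (f i) := by
  classical
  constructor
  · intro x y h
    have hxy : (fun j => f j (Function.update a₀ i x j)) = fun j => f j (Function.update a₀ i y j) := by
      funext j
      by_cases hj : j = i
      · subst hj; simp [h]
      · simp [Function.update_of_ne hj]
    have := congrFun (hf.1 hxy) i
    simpa using this
  · intro b
    obtain ⟨a, ha⟩ := hf.2 (Function.update (fun j => f j (a₀ j)) i b)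
    exact ⟨a i, by simpa using congrFun ha i⟩

/-! ### The natural map of Cor 5.6 (i) factors through the families of local isomorphisms -/

/-- `isoToD φ = {(ℱ̲_v ↦ 𝒟_v)(φ_v)}_v` (definitional). ([IUTchI] Cor 5.6 (i) p.154) [claim: Mochizuki2012, status: disputed] -/
theorem isoToD_eq_local_comp_thIso (H₁ H₂ : FK.ThetaHT) :
    (ThetaHT.isoToD : ThetaHT.Iso H₁ H₂ → H₁.dStrip.Iso H₂.dStrip) =
      (fun (t : ∀ v, H₁.th v ≅ H₂.th v) (v : K.V) => (FK.thToF v ⋙ FK.toD v).mapIso (t v)) ∘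
        fun φ : ThetaHT.Iso H₁ H₂ => φ.thIso :=
  rfl

/-! ### The exact local content of `Cor56iKitCanonical` -/

/-- **Local bijectivity ⇒ Cor 5.6 (i) for canonically framed theaters** (given rigidity L03a and functoriality):
if `ℱ̲_v ↦ 𝒟_v` is bijective on `Aut(ℱ̲_v)` at EVERY `v`, then `Isom(†ℋ𝒯^Θ, ‡ℋ𝒯^Θ) → Isom(†𝔇_>, ‡𝔇_>)` is bijective
for canonical pairs — `φ ↦ φ.thIso` is bijective by `thIso_bijective_of_canonical`, and the local maps by conjugation
transport from the models. PROVED. ([IUTchI] Cor 5.6 (i) p.154) [claim: Mochizuki2012, status: disputed] -/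
theorem cor56iKitCanonical_of_localBijective (hfaith : FK.RlfIsoFaithful) (hnat : FK.RlfOfNatural)
    (hloc : ∀ v, Function.Bijective fun α : FK.thModel v ≅ FK.thModel v => (FK.thToF v ⋙ FK.toD v).mapIso α) :
    FK.Cor56iKitCanonical := by
  intro H₁ H₂ h₁ h₂
  rw [isoToD_eq_local_comp_thIso]
  exact (pi_map_bijective' (fun v (t : H₁.th v ≅ H₂.th v) => (FK.thToF v ⋙ FK.toD v).mapIso t) fun v =>
      mapIso_bijective_conj' _ (hloc v) (H₁.th_isModel v).some (H₂.th_isModel v).some).comp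
    (thIso_bijective_of_canonical hfaith hnat h₁ h₂)

/-- **Cor 5.6 (i) for canonically framed theaters ⇒ local bijectivity at EVERY `v`** (given rigidity L03a,
functoriality and one canonically framed theater `H₀`): apply bijectivity of `isoToD` to the pair `(H₀, H₀)`, peel
off the bijection `φ ↦ φ.thIso`, read off the component at `v` (other coordinates fixed at the identity), and transport
from `Aut(†ℱ̲_v)` to `Aut(ℱ̲_v)` by conjugation. PROVED. ([IUTchI] Cor 5.6 (i) p.154) [claim: Mochizuki2012, status: disputed] -/
theorem localBijective_of_cor56iKitCanonical (hfaith : FK.RlfIsoFaithful) (hnat : FK.RlfOfNatural)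
    (hK : FK.Cor56iKitCanonical) {H₀ : FK.ThetaHT} (h₀ : H₀.IsCanonical) (v : K.V) :
    Function.Bijective fun α : FK.thModel v ≅ FK.thModel v => (FK.thToF v ⋙ FK.toD v).mapIso α := by
  have hD := hK H₀ H₀ h₀ h₀
  rw [isoToD_eq_local_comp_thIso] at hD
  have hT : Function.Bijective fun (t : ∀ w, H₀.th w ≅ H₀.th w) (w : K.V) =>
      (FK.thToF w ⋙ FK.toD w).mapIso (t w) :=
    (Function.Bijective.of_comp_iff _ (thIso_bijective_of_canonical hfaith hnat h₀ h₀)).mp hD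
  have hv := bijective_of_pi_map_bijective (fun w (t : H₀.th w ≅ H₀.th w) => (FK.thToF w ⋙ FK.toD w).mapIso t)
    (fun w => Iso.refl _) hT v
  exact mapIso_bijective_conj' _ hv (H₀.th_isModel v).some.symm (H₀.th_isModel v).some.symm

/-- **The exact local content of Cor 5.6 (i) under ruling (b).**  Given rigidity L03a, functoriality and one
canonically framed Θ-Hodge theater: `Cor56iKitCanonical` ⟺ «`Aut(ℱ̲_v) → Aut(𝒟_v)` is bijective for EVERY `v ∈ 𝕍`»
(Cor 5.3 (iv)'s statement, printed for `v ∈ 𝕍^bad`, at all places).  Rows L02 and L04 = Cor 5.3 (ii) of the sub-DAG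
enter only through this condition (`localBijective_of_rows`). PROVED.
([IUTchI] Cor 5.6 (i) p.154) [claim: Mochizuki2012, status: disputed] -/
theorem cor56iKitCanonical_iff_localBijective (hfaith : FK.RlfIsoFaithful) (hnat : FK.RlfOfNatural) {H₀ : FK.ThetaHT}
    (h₀ : H₀.IsCanonical) :
    FK.Cor56iKitCanonical ↔
      ∀ v, Function.Bijective fun α : FK.thModel v ≅ FK.thModel v => (FK.thToF v ⋙ FK.toD v).mapIso α :=
  ⟨fun hK => localBijective_of_cor56iKitCanonical hfaith hnat hK h₀, cor56iKitCanonical_of_localBijective hfaith hnat⟩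

/-- **Row L05 = Cor 5.3 (iv) is NECESSARY**: under rigidity, functoriality and one canonically framed theater,
`Cor56iKitCanonical` implies `AutTemperedBijective` (the local condition at `v ∈ 𝕍^bad`, verbatim). PROVED.
([IUTchI] Cor 5.3 (iv) p.144) [claim: Mochizuki2012, status: disputed] -/
theorem autTemperedBijective_of_cor56iKitCanonical (hfaith : FK.RlfIsoFaithful) (hnat : FK.RlfOfNatural)
    (hK : FK.Cor56iKitCanonical) {H₀ : FK.ThetaHT} (h₀ : H₀.IsCanonical) : FK.AutTemperedBijective :=
  fun v _ => localBijective_of_cor56iKitCanonical hfaith hnat hK h₀ v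

/-- **Rows L02 + L04 + L05 ⇒ the local condition** (the printed route: at `v ∈ 𝕍^bad` Cor 5.3 (iv); at `v ∈ 𝕍^good`
"`†ℱ_{>,v} = †ℱ̲_v`" (L02) followed by Cor 5.3 (ii) on the single component). PROVED.
([IUTchI] Cor 5.6 (i) p.154) [claim: Mochizuki2012, status: disputed] -/
theorem localBijective_of_rows (h02 : FK.ThToFBijOnGood) (h53ii : FK.IsomFtoDBijective)
    (h53iv : FK.AutTemperedBijective) (v : K.V) :
    Function.Bijective fun α : FK.thModel v ≅ FK.thModel v => (FK.thToF v ⋙ FK.toD v).mapIso α := by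
  by_cases hv : v ∈ K.bad
  · exact h53iv v hv
  · have hD : Function.Bijective fun φ : (FK.thToF v).obj (FK.thModel v) ≅ (FK.thToF v).obj (FK.thModel v) =>
        (FK.toD v).mapIso φ :=
      mapIso_bijective_of_model v (model_bijective_of_isomFtoDBijective h53ii v) (FK.thToF_model v)
        (FK.thToF_model v)
    have hcomp : (fun α : FK.thModel v ≅ FK.thModel v => (FK.thToF v ⋙ FK.toD v).mapIso α) =
        (fun φ : (FK.thToF v).obj (FK.thModel v) ≅ (FK.thToF v).obj (FK.thModel v) => (FK.toD v).mapIso φ) ∘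
          fun α : FK.thModel v ≅ FK.thModel v => (FK.thToF v).mapIso α :=
      funext fun α => Iso.ext rfl
    rw [hcomp]
    exact hD.comp (h02 v hv)

end PMBaseKit.FKit

/-! ### Rows L02 and L04 are NOT necessary: a kit where Cor 5.6 (i) holds and Cor 5.3 (ii) fails -/

namespace PMBaseKit

variable {l : ℕ}

/-- **Cor 5.6 (i) (both typed forms) WITHOUT Cor 5.3 (ii).**  Over ANY base kit with a place `x₀` and any
multiplicative kit there is an `ℱ`-kit in which rigidity L03a, functoriality, Cor 5.3 (iv) at every bad `v`, the local
condition at EVERY `v`, «every Θ-Hodge theater is canonically framed», `Cor56iKitCanonical` AND the all-framings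
`Cor56iKit` HOLD, whereas Cor 5.3 (ii) `IsomFtoDBijective` FAILS, L02 `ThToFBijOnGood` fails at every good place (and
holds if every place is bad).  Construction (inside the proof): `ℱ_v`-ambient `(isomorphs of 𝒟_v) × SingleObj ℤˣ`,
base functor the first projection, `ℱ̲_v ↦ ℱ_v` = `A ↦ (A, ⋆)`, `ℱ^⊢`/`𝔉^⊩`-ambients one-point; the automorphism `−1`
of the invisible factor lies over the identity of `𝒟_v`. PROVED. ([IUTchI] Cor 5.6 (i) p.154) [claim: Mochizuki2012, status: disputed] -/
theorem exists_fkit_cor56iKit_not_isomFtoDBijective (K : PMBaseKit.{0} l) (M : K.MultKit) (x₀ : K.V) :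
    ∃ FK : K.FKit M,
      FK.RlfIsoFaithful ∧ FK.RlfOfNatural ∧ FK.AutTemperedBijective ∧
        (∀ v, Function.Bijective fun α : FK.thModel v ≅ FK.thModel v => (FK.thToF v ⋙ FK.toD v).mapIso α) ∧
        (∀ H : FK.ThetaHT, H.IsCanonical) ∧ FK.Cor56iKitCanonical ∧ FK.Cor56iKit ∧ ¬ FK.IsomFtoDBijective ∧
        (∀ v, v ∉ K.bad → ¬ FK.ThToFBijOnGood) ∧ ((∀ v, v ∈ K.bad) → FK.ThToFBijOnGood) := by
  let FK : K.FKit M :=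
    { FAmb := fun x => ObjectProperty.FullSubcategory (K.IsLocal x) × SingleObj ℤˣ
      fModel := fun x => (⟨K.model x, K.isLocal_model x⟩, SingleObj.star ℤˣ)
      FmAmb := fun _ => SingleObj Unit
      fmModel := fun _ => SingleObj.star Unit
      toD := fun x => CategoryTheory.Prod.fst _ _ ⋙ ObjectProperty.ι (K.IsLocal x)
      toD_model := fun _ => Iso.refl _
      toFm := fun x =>
        (Functor.const (ObjectProperty.FullSubcategory (K.IsLocal x) × SingleObj ℤˣ)).obj (SingleObj.star Unit)
      toFm_model := fun _ => Iso.refl _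
      RlfAmb := SingleObj Unit
      rlfModel := SingleObj.star Unit
      rlfFm := fun _ => (Functor.const (SingleObj Unit)).obj (SingleObj.star Unit)
      rlfOf := fun _ => SingleObj.star Unit
      rlfOfMap := fun _ => Iso.refl _
      rlfFm_rlfOf := fun _ _ => Iso.refl _
      ThAmb := fun x => ObjectProperty.FullSubcategory (K.IsLocal x)
      thModel := fun x => ⟨K.model x, K.isLocal_model x⟩
      thToF := fun x => (𝟭 _).prod' ((Functor.const _).obj (SingleObj.star ℤˣ))
      thToF_model := fun _ => Iso.refl _
      toDm := fun _ => M.mono ⟨fun v => K.model v, fun v => K.isLocal_model v⟩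
      toDmMap := fun _ => 𝟙 _
      toDm_toFm := fun F hF =>
        ⟨M.monoMap fun v => (CategoryTheory.Prod.fst _ _ ⋙ ObjectProperty.ι (K.IsLocal v)).mapIso (hF v).some.symm⟩ }
  have hfaith : FK.RlfIsoFaithful := fun _ _ a b _ => Iso.ext (Subsingleton.elim (α := Unit) a.hom b.hom)
  have hnat : FK.RlfOfNatural := fun _ _ _ _ => rfl
  -- `ℱ̲_v ↦ ℱ_v ↦ 𝒟_v` is the (fully faithful) inclusion of the isomorphs of `𝒟_v`
  have hloc : ∀ v, Function.Bijective fun α : FK.thModel v ≅ FK.thModel v => (FK.thToF v ⋙ FK.toD v).mapIso α :=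
    fun v => ((Functor.FullyFaithful.id _).comp (ObjectProperty.fullyFaithfulι (K.IsLocal v))).isoEquiv.bijective
  have h53iv : FK.AutTemperedBijective := fun v _ => hloc v
  have hcan : ∀ H : FK.ThetaHT, H.IsCanonical := fun H =>
    ⟨Iso.refl _, fun v => Subsingleton.elim (α := Unit) _ _⟩
  have hKc : FK.Cor56iKitCanonical := FKit.cor56iKitCanonical_of_localBijective hfaith hnat hloc
  have hK : FK.Cor56iKit := fun H₁ H₂ => hKc H₁ H₂ (hcan H₁) (hcan H₂)
  -- the automorphism `−1` of the invisible factor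
  let neg : (SingleObj.star ℤˣ : SingleObj ℤˣ) ≅ SingleObj.star ℤˣ :=
    ⟨(-1 : ℤˣ), (-1 : ℤˣ), by show (-1 : ℤˣ) * (-1) = 1; rw [neg_mul_neg, mul_one],
      by show (-1 : ℤˣ) * (-1) = 1; rw [neg_mul_neg, mul_one]⟩
  have h53ii : ¬ FK.IsomFtoDBijective := by
    intro h
    let F₀ : FK.FStrip := ⟨FK.fModel, fun _ => ⟨Iso.refl _⟩⟩
    let φ₁ : F₀.Iso F₀ := fun _ => Iso.refl _
    let φ₂ : F₀.Iso F₀ := fun _ => Iso.prod (Iso.refl _) neg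
    have himg : FKit.FStrip.assocDMap φ₁ = FKit.FStrip.assocDMap φ₂ := funext fun _ => Iso.ext rfl
    have heq := congrArg (fun φ : F₀.Iso F₀ => (φ x₀).hom.2) ((h F₀ F₀).1 himg)
    change (1 : ℤˣ) = -1 at heq
    exact absurd heq (by decide)
  have h02bad : ∀ v, v ∉ K.bad → ¬ FK.ThToFBijOnGood := by
    intro v hv h
    obtain ⟨α, hα⟩ := (h v hv).2 (Iso.prod (Iso.refl _) neg)
    have heq := congrArg (fun ψ : (FK.thToF v).obj (FK.thModel v) ≅ (FK.thToF v).obj (FK.thModel v) => ψ.hom.2) hα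
    change (1 : ℤˣ) = -1 at heq
    exact absurd heq (by decide)
  have h02good : (∀ v, v ∈ K.bad) → FK.ThToFBijOnGood := fun hall v hv => absurd (hall v) hv
  exact ⟨FK, hfaith, hnat, h53iv, hloc, hcan, hKc, hK, h53ii, h02bad, h02good⟩

/-- **Row L04 = Cor 5.3 (ii) is NOT necessary for Cor 5.6 (i) as typed**: it is FALSE that, over every base kit of
level `l` (prime, `≠ 2`), rigidity + functoriality + Cor 5.3 (iv) + «every theater canonical» + `Cor56iKit` imply
`IsomFtoDBijective` (witness over abc-iut-L5-t4's `toyKit`, whose index set is a point). PROVED.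
([IUTchI] Cor 5.3 (ii) p.144) [claim: Mochizuki2012, status: disputed] -/
theorem not_forall_isomFtoDBijective_of_cor56iKit (l : ℕ) [Fact l.Prime] (hl : l ≠ 2) :
    ¬ ∀ (K : PMBaseKit.{0} l) (M : K.MultKit) (FK : K.FKit M),
        FK.RlfIsoFaithful → FK.RlfOfNatural → FK.AutTemperedBijective → (∀ H : FK.ThetaHT, H.IsCanonical) →
          FK.Cor56iKit → FK.IsomFtoDBijective := by
  intro h
  obtain ⟨FK, hfaith, hnat, h53iv, -, hcan, -, hK, h53ii, -, -⟩ :=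
    (toyKit l hl).exists_fkit_cor56iKit_not_isomFtoDBijective (MultKit.toy l hl) PUnit.unit
  exact h53ii (h _ _ FK hfaith hnat h53iv hcan hK)

/-- **Row L02 is NOT necessary either**: it is FALSE that, over every base kit of level `l`, rigidity +
functoriality + Cor 5.3 (iv) + «every theater canonical» + `Cor56iKit` imply `ThToFBijOnGood` (witness over `toyKit`
with NO bad place, so its point is a good place). PROVED. ([IUTchI] Cor 5.6 (i) p.154) [claim: Mochizuki2012, status: disputed] -/
theorem not_forall_thToFBijOnGood_of_cor56iKit (l : ℕ) [Fact l.Prime] (hl : l ≠ 2) :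
    ¬ ∀ (K : PMBaseKit.{0} l) (M : K.MultKit) (FK : K.FKit M),
        FK.RlfIsoFaithful → FK.RlfOfNatural → FK.AutTemperedBijective → (∀ H : FK.ThetaHT, H.IsCanonical) →
          FK.Cor56iKit → FK.ThToFBijOnGood := by
  intro h
  let K₀ : PMBaseKit.{0} l := { toyKit l hl with bad := ∅, arc := ∅ }
  let M₀ : K₀.MultKit :=
    { DMono := SingleObj Unit
      mono := fun _ => SingleObj.star Unit
      monoMap := fun _ => 𝟙 _
      thetaPolyBad := fun _ _ _ => ∅ }
  obtain ⟨FK, hfaith, hnat, h53iv, -, hcan, -, hK, -, h02bad, -⟩ :=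
    K₀.exists_fkit_cor56iKit_not_isomFtoDBijective M₀ PUnit.unit
  exact h02bad PUnit.unit (Finset.notMem_empty _) (h K₀ M₀ FK hfaith hnat h53iv hcan hK)

end PMBaseKit

end Literature.IUT.HodgeTheaters
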